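import Summits.HubbardSuperconductivity.HubbardSuperconductivity.Theorems.BalabanIRBirGroundStateAverageLROSoftminTransfer
import Summits.HubbardSuperconductivity.HubbardSuperconductivity.Theorems.BalabanIRBirGroundStateAverageLROSoftminTransferIsotropic

/-!
# Route BalabanIR — crux `BirGroundStateAverageLRO` (item `stmt-HubbardSuperconductivity-2079`), line `Sketch` (softmin-pair-penalty): the FREE-SCHEDULE transfer

The two landed sockets of line `Sketch` fix a schedule for the engine: R1 (`transfer_tower`,
`β_L = θL²`, entropy budget `log dim S ≤ L² log 4`, `θκx ≥ 4 log 4`) and R2 (`transfer_isotropic`,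
`β_L = θL`, state count `≤ C·L/θ`, `4C ≤ θ²κx`). Both are instances of ONE schedule-free socket,
proved here from the landed abstract chains `softmin_chain` / `softmin_chain_entropic`:

* `everyGroundState_of_freeFloorAt` — at side `L`, coupling `U`: if for SOME inverse temperature
  `β > 0`, SOME penalty strength `κ > 0` and SOME entropy budget `σ` with `4σ ≤ βκx` the canonical
  `(2⌊(1-δ)L²/2⌋, S^z = 0)` Gibbs state of `K = hubbardTorus 2 L 1 U + (κ/L⁴) Δ_d†Δ_d` has the
  floor `⟨Δ_d†Δ_d⟩ ≥ x L⁴` (real sector traces) and `σ` dominates EITHER the state count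
  `log Re tr(P_S e^{-β(H - e_S)})` of the unpenalised `H` OR the free bound `L² log 4`, then every
  normalised sector ground state `ψ` of `H` has `Re⟨ψ, Δ_d†Δ_d ψ⟩ ≥ (x/2) L⁴`.
* `transfer_free` (= the registered stub `stub_transferFree` of the pass-2 skeleton
  `Cruxes/BirGroundStateAverageLRO/Lines/Sketch.lean`) — the crux `BirGroundStateAverageLRO`
  (constant `c = x/2`) from that floor on a window of couplings, eventually in even `L`, with
  `β, κ, σ` chosen freely per `(U, L)` by the engine (only `x` is uniform).
* `freeFloorAt_of_towerFloorAt`, `freeFloorAt_of_isotropicFloorAt` — the R1 and R2 data are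
  instances (nothing registered before is lost by the reshape of the line's engine stub).

Sources: R. Peierls, Phys. Rev. 54 (1938) 918; Gibbs variational principle / Peierls–Bogoliubov,
B. Simon, *The Statistical Mechanics of Lattice Gases* I (1993) §I.8, Thm. I.8.6; H. Tasaki (2020)
App. A. Folklore; no definition is introduced.
-/

noncomputable section

namespace Summit.HubbardSuperconductivity.HubbardSuperconductivity.Theorems.BirGroundStateAverageLRO.Softmin

open Matrix Finset Filter Literature.MathematicalPhysics.QuantumLattice Literature.Probability.LatticeModels
open Summit.HubbardSuperconductivity.HubbardSuperconductivity.Theses.BalabanIR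
open Summit.HubbardSuperconductivity.HubbardSuperconductivity.Theorems
open scoped ComplexOrder

section Hubbard

/-- **Every sector ground state inherits the penalised thermal floor — free schedule.** At side
`L`, coupling `U`, doping parameter `δ`: if for some `β > 0`, `κ > 0` and `σ` with `4σ ≤ βκx` the
canonical `(2⌊(1-δ)L²/2⌋, S^z = 0)` Gibbs state at inverse temperature `β` of
`K = hubbardTorus 2 L 1 U + (κ/L⁴)Δ_d†Δ_d` has `⟨Δ_d†Δ_d⟩ ≥ xL⁴` (real traces), and `σ` bounds
either the state count `log Re tr(P_S e^{-β(H - e_S)})` (`e_S = minEnergyOn H S`) or the free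
entropy `L² log 4`, then every normalised sector ground state `ψ` of `hubbardTorus 2 L 1 U` has
`(x/2)L⁴ ≤ Re⟨ψ, Δ_d†Δ_d ψ⟩`. [folklore] -/
theorem everyGroundState_of_freeFloorAt (L : ℕ) [NeZero L] (U δ κ x β σ : ℝ)
    (hκ : 0 < κ) (hx : 0 < x) (hβ : 0 < β) (hbudget : 4 * σ ≤ β * κ * x)
    (hfloor :
      x * (L : ℝ) ^ 4 *
          (projMatrix ((szSector (Λ := FermionTorus 2 L) (2 * ⌊(1 - δ) * (L : ℝ) ^ 2 / 2⌋₊) 0).map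
              (Fock.toEuclidean (ι := Orb (FermionTorus 2 L)) :
                Fock (Orb (FermionTorus 2 L)) →ₗ[ℂ]
                  EuclideanSpace ℂ (Finset (Orb (FermionTorus 2 L))))) *
            gibbsWeight β (hubbardTorus 2 L 1 U +
              ((κ / (L : ℝ) ^ 4 : ℝ) : ℂ) •
                ((pairField dWaveFormFactor L)ᴴ * pairField dWaveFormFactor L))).trace.re ≤
        (projMatrix ((szSector (Λ := FermionTorus 2 L) (2 * ⌊(1 - δ) * (L : ℝ) ^ 2 / 2⌋₊) 0).map
              (Fock.toEuclidean (ι := Orb (FermionTorus 2 L)) :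
                Fock (Orb (FermionTorus 2 L)) →ₗ[ℂ]
                  EuclideanSpace ℂ (Finset (Orb (FermionTorus 2 L))))) *
            gibbsWeight β (hubbardTorus 2 L 1 U +
              ((κ / (L : ℝ) ^ 4 : ℝ) : ℂ) •
                ((pairField dWaveFormFactor L)ᴴ * pairField dWaveFormFactor L)) *
          ((pairField dWaveFormFactor L)ᴴ * pairField dWaveFormFactor L)).trace.re)
    (hσ :
      Real.log ((projMatrix ((szSector (Λ := FermionTorus 2 L)
            (2 * ⌊(1 - δ) * (L : ℝ) ^ 2 / 2⌋₊) 0).map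
              (Fock.toEuclidean (ι := Orb (FermionTorus 2 L)) :
                Fock (Orb (FermionTorus 2 L)) →ₗ[ℂ]
                  EuclideanSpace ℂ (Finset (Orb (FermionTorus 2 L))))) *
          gibbsWeight β (hubbardTorus 2 L 1 U -
            ((((hubbardTorus 2 L 1 U).minEnergyOn
              (szSector (Λ := FermionTorus 2 L) (2 * ⌊(1 - δ) * (L : ℝ) ^ 2 / 2⌋₊) 0) : ℝ) : ℂ) •
              (1 : Matrix (Finset (Orb (FermionTorus 2 L))) (Finset (Orb (FermionTorus 2 L))) ℂ)))).trace.re) ≤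
        σ ∨ (L : ℝ) ^ 2 * Real.log 4 ≤ σ) :
    ∀ ψ : Fock (Orb (FermionTorus 2 L)),
      IsGroundStateInSector (hubbardTorus 2 L 1 U) (2 * ⌊(1 - δ) * (L : ℝ) ^ 2 / 2⌋₊) 0 ψ →
      star ψ ⬝ᵥ ψ = 1 →
      x / 2 * (L : ℝ) ^ 4 ≤
        (star ψ ⬝ᵥ ((pairField dWaveFormFactor L)ᴴ * pairField dWaveFormFactor L) *ᵥ ψ).re := by
  intro ψ hgs h1
  set m : ℕ := ⌊(1 - δ) * (L : ℝ) ^ 2 / 2⌋₊ with hmdef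
  set H := hubbardTorus 2 L 1 U with hHdef
  set S := szSector (Λ := FermionTorus 2 L) (2 * m) 0 with hSdef
  set P := projMatrix (S.map (Fock.toEuclidean (ι := Orb (FermionTorus 2 L)) :
    Fock (Orb (FermionTorus 2 L)) →ₗ[ℂ] EuclideanSpace ℂ (Finset (Orb (FermionTorus 2 L)))))
    with hPdef
  set A := (pairField dWaveFormFactor L)ᴴ * pairField dWaveFormFactor L with hAdef
  set e : ℝ := H.minEnergyOn S with hedef
  have hL : (0 : ℝ) < (L : ℝ) := by exact_mod_cast Nat.pos_of_ne_zero (NeZero.ne L)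
  have hL4 : (0 : ℝ) < (L : ℝ) ^ 4 := by positivity
  have hg : 0 ≤ κ / (L : ℝ) ^ 4 := (div_pos hκ hL4).le
  have hH : H.IsHermitian := LiebThm1.hamiltonian_isHermitian (fermionTorusGraph 2 L) 1 U
  have hA : A.IsHermitian := Matrix.isHermitian_conjTranspose_mul_self _
  have hSH : ∀ v ∈ S, H *ᵥ v ∈ S := fun v hv => hubbardTorus_mulVec_mem_szSector 2 L 1 U m hv
  have hSA : ∀ v ∈ S, A *ᵥ v ∈ S := fun v hv => pairPenalty_mulVec_mem_szSector L m hv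
  have hPh : P.IsHermitian := projMatrix_isHermitian _
  have hPP : P * P = P := projMatrix_mul_self _
  have hPH : Commute P H := projMatrix_map_commute_of_invariant hH S hSH
  have hPA : Commute P A := stub_sectorProjCommutePair L m
  obtain ⟨hψS, hψ0, hHψ⟩ := hgs
  have hS0 : S ≠ ⊥ := by
    rw [Submodule.ne_bot_iff]; exact ⟨ψ, hψS, hψ0⟩
  have hPψ : P *ᵥ ψ = ψ := projMatrix_map_mulVec_of_mem S hψS
  have he : ∀ φ : Fock (Orb (FermionTorus 2 L)), P *ᵥ φ = φ → star φ ⬝ᵥ φ = 1 →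
      e ≤ (star φ ⬝ᵥ (H *ᵥ φ)).re := by
    intro φ hPφ hφ1
    have hφS : φ ∈ S := by rw [← hPφ]; exact projMatrix_map_mulVec_mem S φ
    exact minEnergyOn_le_rayleigh_of_mem hH S hφS hφ1
  have hk : κ / (L : ℝ) ^ 4 * (x * (L : ℝ) ^ 4) = κ * x := by field_simp
  -- the chain, in either entropy accounting: `κ x - σ/β ≤ (κ/L⁴) Re⟨ψ, Aψ⟩`
  have hkey : κ * x - σ / β ≤ κ / (L : ℝ) ^ 4 * (star ψ ⬝ᵥ (A *ᵥ ψ)).re := by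
    rcases hσ with hcount | hfree
    · -- entropy dial: the engine's own state count
      have hchain := softmin_chain_entropic S hS0 hH hA hSH hSA hβ hg (x * (L : ℝ) ^ 4) e σ ψ hψS
        h1 hHψ hfloor hcount
      rwa [hk] at hchain
    · -- free entropy: `log Re tr P_S ≤ L² log 4 ≤ σ`
      have hchain := softmin_chain P H A hPP hPh hPH hPA hH hA hβ hg (x * (L : ℝ) ^ 4) e he ψ hPψ
        h1 hHψ hfloor
      rw [hk] at hchain
      have hlogP : Real.log (P.trace.re) ≤ (L : ℝ) ^ 2 * Real.log 4 :=
        stub_logTraceSectorProjLe L _ _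
      have hdiv : Real.log (P.trace.re) / β ≤ σ / β :=
        div_le_div_of_nonneg_right (hlogP.trans hfree) hβ.le
      linarith
  -- budget: `σ/β ≤ κ x / 4`
  have hbud : σ / β ≤ κ * x / 4 := by
    rw [div_le_div_iff₀ hβ (by norm_num : (0:ℝ) < 4)]
    linarith
  have hfinal : 3 / 4 * (κ * x) ≤ κ / (L : ℝ) ^ 4 * (star ψ ⬝ᵥ (A *ᵥ ψ)).re := by linarith
  have hq : x / 2 * (L : ℝ) ^ 4 ≤ 3 / 4 * x * (L : ℝ) ^ 4 := by nlinarith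
  refine hq.trans ?_
  have h3 : 3 / 4 * x * (L : ℝ) ^ 4 = (3 / 4 * (κ * x)) / (κ / (L : ℝ) ^ 4) := by
    field_simp
  rw [h3, div_le_iff₀ (div_pos hκ hL4)]
  linarith

/-- **Transfer, free schedule** (the weakest socket of line `Sketch`): if, for some
`δ ∈ (0,1/2)`, window `0 < U₁ < U₂` and floor `x > 0`, for every `U` in the window and eventually
in even `L` the engine supplies SOME `β > 0`, `κ > 0`, `σ` with `4σ ≤ βκx`, the penalised thermal
floor `x·L⁴·Re tr(P_S e^{-βK}) ≤ Re tr(P_S e^{-βK} Δ_d†Δ_d)` (`K = H + (κ/L⁴)Δ_d†Δ_d`) and an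
entropy certificate (`log Re tr(P_S e^{-β(H - e_S)}) ≤ σ` or `L² log 4 ≤ σ`), then
`BirGroundStateAverageLRO` holds with `c = x/2`. R1 (`β = θL²`, `σ = L² log 4`) and R2 (`β = θL`,
`σ = C·L/θ`) are instances. [folklore] -/
theorem transfer_free (δ U₁ U₂ x : ℝ) (hδ : δ ∈ Set.Ioo (0 : ℝ) (1 / 2)) (hU₁ : 0 < U₁)
    (hU₁₂ : U₁ < U₂) (hx : 0 < x)
    (h : ∀ U ∈ Set.Ioo U₁ U₂, ∃ L₀ : ℕ, ∀ (L : ℕ) [NeZero L], L₀ ≤ L → Even L →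
      let N : ℕ := 2 * ⌊(1 - δ) * (L : ℝ) ^ 2 / 2⌋₊
      let H := hubbardTorus 2 L 1 U
      let S := szSector (Λ := FermionTorus 2 L) N 0
      let P := projMatrix (S.map (Fock.toEuclidean (ι := Orb (FermionTorus 2 L)) :
        Fock (Orb (FermionTorus 2 L)) →ₗ[ℂ] EuclideanSpace ℂ (Finset (Orb (FermionTorus 2 L)))))
      let A := (pairField dWaveFormFactor L)ᴴ * pairField dWaveFormFactor L
      let e : ℝ := H.minEnergyOn S
      ∃ β κ σ : ℝ, 0 < β ∧ 0 < κ ∧ 4 * σ ≤ β * κ * x ∧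
        x * (L : ℝ) ^ 4 * (P * gibbsWeight β (H + ((κ / (L : ℝ) ^ 4 : ℝ) : ℂ) • A)).trace.re ≤
          (P * gibbsWeight β (H + ((κ / (L : ℝ) ^ 4 : ℝ) : ℂ) • A) * A).trace.re ∧
        (Real.log ((P * gibbsWeight β (H - ((e : ℝ) : ℂ) • 1)).trace.re) ≤ σ ∨
          (L : ℝ) ^ 2 * Real.log 4 ≤ σ)) :
    BirGroundStateAverageLRO := by
  refine birGroundStateAverageLRO_of_forall_groundState
    ⟨δ, hδ, U₁, U₂, x / 2, hU₁, hU₁₂, by positivity, fun U hU => ?_⟩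
  obtain ⟨L₀, hL₀⟩ := h U hU
  refine ⟨L₀, fun L _ hL hLe => ?_⟩
  obtain ⟨β, κ, σ, hβ, hκ, hbudget, hfl, hσ⟩ := hL₀ L hL hLe
  exact everyGroundState_of_freeFloorAt L U δ κ x β σ hκ hx hβ hbudget hfl hσ

/-- STUB of line `Sketch` (lead-held, pass 2; registered skeleton `b27fd227`). **Transfer, free
schedule** — alias of `transfer_free`: if for some `δ ∈ (0,1/2)`, window `0 < U₁ < U₂` and floor
`x > 0`, for every `U` in the window and eventually in even `L` there are `β > 0`, `κ > 0`, `σ`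
with `4σ ≤ βκx`, the penalised thermal floor `x·L⁴·Re tr(P_S e^{-βK}) ≤ Re tr(P_S e^{-βK} Δ_d†Δ_d)`
(`K = H + (κ/L⁴)Δ_d†Δ_d`) and an entropy certificate (`log Re tr(P_S e^{-β(H - e_S)}) ≤ σ` or
`L² log 4 ≤ σ`), then the crux holds (constant `c = x/2`). [folklore] -/
theorem stub_transferFree (δ U₁ U₂ x : ℝ) (hδ : δ ∈ Set.Ioo (0 : ℝ) (1 / 2)) (hU₁ : 0 < U₁)
    (hU₁₂ : U₁ < U₂) (hx : 0 < x)
    (h : ∀ U ∈ Set.Ioo U₁ U₂, ∃ L₀ : ℕ, ∀ (L : ℕ) [NeZero L], L₀ ≤ L → Even L →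
      let N : ℕ := 2 * ⌊(1 - δ) * (L : ℝ) ^ 2 / 2⌋₊
      let H := hubbardTorus 2 L 1 U
      let S := szSector (Λ := FermionTorus 2 L) N 0
      let P := projMatrix (S.map (Fock.toEuclidean (ι := Orb (FermionTorus 2 L)) :
        Fock (Orb (FermionTorus 2 L)) →ₗ[ℂ] EuclideanSpace ℂ (Finset (Orb (FermionTorus 2 L)))))
      let A := (pairField dWaveFormFactor L)ᴴ * pairField dWaveFormFactor L
      let e : ℝ := H.minEnergyOn S
      ∃ β κ σ : ℝ, 0 < β ∧ 0 < κ ∧ 4 * σ ≤ β * κ * x ∧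
        x * (L : ℝ) ^ 4 * (P * gibbsWeight β (H + ((κ / (L : ℝ) ^ 4 : ℝ) : ℂ) • A)).trace.re ≤
          (P * gibbsWeight β (H + ((κ / (L : ℝ) ^ 4 : ℝ) : ℂ) • A) * A).trace.re ∧
        (Real.log ((P * gibbsWeight β (H - ((e : ℝ) : ℂ) • 1)).trace.re) ≤ σ ∨
          (L : ℝ) ^ 2 * Real.log 4 ≤ σ)) :
    BirGroundStateAverageLRO :=
  transfer_free δ U₁ U₂ x hδ hU₁ hU₁₂ hx h

/-- **R1 is an instance of the free schedule.** At fixed `(U, L)`: the tower data (`β = θL²`,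
`θκx ≥ 4 log 4`, floor) give the free data with `σ = L² log 4`. [folklore] -/
theorem freeFloorAt_of_towerFloorAt (L : ℕ) [NeZero L] {κ x θ : ℝ} (hκ : 0 < κ) (hx : 0 < x)
    (hθ : 4 * Real.log 4 ≤ θ * κ * x) {Fl : ℝ → ℝ → Prop} {Ct : ℝ → ℝ → Prop}
    (hfloor : Fl (θ * (L : ℝ) ^ 2) κ) :
    ∃ β κ' σ : ℝ, 0 < β ∧ 0 < κ' ∧ 4 * σ ≤ β * κ' * x ∧ Fl β κ' ∧
      (Ct β σ ∨ (L : ℝ) ^ 2 * Real.log 4 ≤ σ) := by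
  have hL : (0 : ℝ) < (L : ℝ) := by exact_mod_cast Nat.pos_of_ne_zero (NeZero.ne L)
  have hL2 : (0 : ℝ) < (L : ℝ) ^ 2 := by positivity
  have hθpos : 0 < θ := by
    by_contra hθ0
    push Not at hθ0
    have : θ * κ * x ≤ 0 := by
      have := mul_nonpos_of_nonpos_of_nonneg (mul_nonpos_of_nonpos_of_nonneg hθ0 hκ.le) hx.le
      simpa [mul_assoc] using this
    have hlog4 : 0 < Real.log 4 := Real.log_pos (by norm_num)
    linarith
  refine ⟨θ * (L : ℝ) ^ 2, κ, (L : ℝ) ^ 2 * Real.log 4, mul_pos hθpos hL2, hκ, ?_, hfloor,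
    Or.inr le_rfl⟩
  have := mul_le_mul_of_nonneg_left hθ hL2.le
  nlinarith

/-- **R2 is an instance of the free schedule.** At fixed `(U, L)`: the isotropic data (`β = θL`,
`θ > 0`, `4C ≤ θ²κx`, floor, state count `≤ C·L/θ`) give the free data with `σ = C·L/θ`.
[folklore] -/
theorem freeFloorAt_of_isotropicFloorAt (L : ℕ) [NeZero L] {κ x θ C : ℝ} (hκ : 0 < κ)
    (hθ : 0 < θ) (hC : 4 * C ≤ θ ^ 2 * κ * x) {Fl : ℝ → ℝ → Prop} {Ct : ℝ → ℝ → Prop}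
    (hfloor : Fl (θ * (L : ℝ)) κ) (hcount : Ct (θ * (L : ℝ)) (C * (L : ℝ) / θ)) :
    ∃ β κ' σ : ℝ, 0 < β ∧ 0 < κ' ∧ 4 * σ ≤ β * κ' * x ∧ Fl β κ' ∧
      (Ct β σ ∨ (L : ℝ) ^ 2 * Real.log 4 ≤ σ) := by
  have hL : (0 : ℝ) < (L : ℝ) := by exact_mod_cast Nat.pos_of_ne_zero (NeZero.ne L)
  refine ⟨θ * (L : ℝ), κ, C * (L : ℝ) / θ, mul_pos hθ hL, hκ, ?_, hfloor, Or.inl hcount⟩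
  rw [show 4 * (C * (L : ℝ) / θ) = (4 * C) * (L : ℝ) / θ by ring, div_le_iff₀ hθ]
  have := mul_le_mul_of_nonneg_right hC hL.le
  nlinarith

/-- **Nothing is lost by the reshape.** The pass-1 engine stub of line `Sketch`
(`stub_penalisedThermalFloor` = R1-data ∨ R2-data, the hypotheses of `transfer_tower` /
`transfer_isotropic`) implies the free-schedule data consumed by `transfer_free`. [folklore] -/
theorem freeFloor_of_penalisedThermalFloor
    (h : (∃ δ ∈ Set.Ioo (0 : ℝ) (1 / 2), ∃ U₁ U₂ κ x θ : ℝ, 0 < U₁ ∧ U₁ < U₂ ∧ 0 < κ ∧ 0 < x ∧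
      4 * Real.log 4 ≤ θ * κ * x ∧
      ∀ U ∈ Set.Ioo U₁ U₂, ∃ L₀ : ℕ, ∀ (L : ℕ) [NeZero L], L₀ ≤ L → Even L →
        let N : ℕ := 2 * ⌊(1 - δ) * (L : ℝ) ^ 2 / 2⌋₊
        let H := hubbardTorus 2 L 1 U
        let S := szSector (Λ := FermionTorus 2 L) N 0
        let P := projMatrix (S.map (Fock.toEuclidean (ι := Orb (FermionTorus 2 L)) :
          Fock (Orb (FermionTorus 2 L)) →ₗ[ℂ] EuclideanSpace ℂ (Finset (Orb (FermionTorus 2 L)))))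
        let A := (pairField dWaveFormFactor L)ᴴ * pairField dWaveFormFactor L
        let K := H + ((κ / (L : ℝ) ^ 4 : ℝ) : ℂ) • A
        let β : ℝ := θ * (L : ℝ) ^ 2
        x * (L : ℝ) ^ 4 * (P * gibbsWeight β K).trace.re ≤ (P * gibbsWeight β K * A).trace.re) ∨
    (∃ δ ∈ Set.Ioo (0 : ℝ) (1 / 2), ∃ U₁ U₂ κ x θ C : ℝ, 0 < U₁ ∧ U₁ < U₂ ∧ 0 < κ ∧ 0 < x ∧
      0 < θ ∧ 4 * C ≤ θ ^ 2 * κ * x ∧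
      ∀ U ∈ Set.Ioo U₁ U₂, ∃ L₀ : ℕ, ∀ (L : ℕ) [NeZero L], L₀ ≤ L → Even L →
        let N : ℕ := 2 * ⌊(1 - δ) * (L : ℝ) ^ 2 / 2⌋₊
        let H := hubbardTorus 2 L 1 U
        let S := szSector (Λ := FermionTorus 2 L) N 0
        let P := projMatrix (S.map (Fock.toEuclidean (ι := Orb (FermionTorus 2 L)) :
          Fock (Orb (FermionTorus 2 L)) →ₗ[ℂ] EuclideanSpace ℂ (Finset (Orb (FermionTorus 2 L)))))
        let A := (pairField dWaveFormFactor L)ᴴ * pairField dWaveFormFactor L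
        let K := H + ((κ / (L : ℝ) ^ 4 : ℝ) : ℂ) • A
        let β : ℝ := θ * (L : ℝ)
        let e : ℝ := H.minEnergyOn S
        x * (L : ℝ) ^ 4 * (P * gibbsWeight β K).trace.re ≤ (P * gibbsWeight β K * A).trace.re ∧
          Real.log ((P * gibbsWeight β (H - ((e : ℝ) : ℂ) • 1)).trace.re) ≤ C * (L : ℝ) / θ)) :
    ∃ δ ∈ Set.Ioo (0 : ℝ) (1 / 2), ∃ U₁ U₂ x : ℝ, 0 < U₁ ∧ U₁ < U₂ ∧ 0 < x ∧
      ∀ U ∈ Set.Ioo U₁ U₂, ∃ L₀ : ℕ, ∀ (L : ℕ) [NeZero L], L₀ ≤ L → Even L →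
        let N : ℕ := 2 * ⌊(1 - δ) * (L : ℝ) ^ 2 / 2⌋₊
        let H := hubbardTorus 2 L 1 U
        let S := szSector (Λ := FermionTorus 2 L) N 0
        let P := projMatrix (S.map (Fock.toEuclidean (ι := Orb (FermionTorus 2 L)) :
          Fock (Orb (FermionTorus 2 L)) →ₗ[ℂ] EuclideanSpace ℂ (Finset (Orb (FermionTorus 2 L)))))
        let A := (pairField dWaveFormFactor L)ᴴ * pairField dWaveFormFactor L
        let e : ℝ := H.minEnergyOn S
        ∃ β κ σ : ℝ, 0 < β ∧ 0 < κ ∧ 4 * σ ≤ β * κ * x ∧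
          x * (L : ℝ) ^ 4 * (P * gibbsWeight β (H + ((κ / (L : ℝ) ^ 4 : ℝ) : ℂ) • A)).trace.re ≤
            (P * gibbsWeight β (H + ((κ / (L : ℝ) ^ 4 : ℝ) : ℂ) • A) * A).trace.re ∧
          (Real.log ((P * gibbsWeight β (H - ((e : ℝ) : ℂ) • 1)).trace.re) ≤ σ ∨
            (L : ℝ) ^ 2 * Real.log 4 ≤ σ) := by
  rcases h with ⟨δ, hδ, U₁, U₂, κ, x, θ, hU₁, hU₁₂, hκ, hx, hθ, h⟩ |
    ⟨δ, hδ, U₁, U₂, κ, x, θ, C, hU₁, hU₁₂, hκ, hx, hθ, hC, h⟩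
  · refine ⟨δ, hδ, U₁, U₂, x, hU₁, hU₁₂, hx, fun U hU => ?_⟩
    obtain ⟨L₀, hL₀⟩ := h U hU
    refine ⟨L₀, fun L _ hL hLe => ?_⟩
    have hfl := hL₀ L hL hLe
    exact freeFloorAt_of_towerFloorAt L hκ hx hθ
      (Fl := fun β κ' => x * (L : ℝ) ^ 4 *
          (projMatrix ((szSector (Λ := FermionTorus 2 L) (2 * ⌊(1 - δ) * (L : ℝ) ^ 2 / 2⌋₊) 0).map
              (Fock.toEuclidean (ι := Orb (FermionTorus 2 L)) :
                Fock (Orb (FermionTorus 2 L)) →ₗ[ℂ]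
                  EuclideanSpace ℂ (Finset (Orb (FermionTorus 2 L))))) *
            gibbsWeight β (hubbardTorus 2 L 1 U + ((κ' / (L : ℝ) ^ 4 : ℝ) : ℂ) •
              ((pairField dWaveFormFactor L)ᴴ * pairField dWaveFormFactor L))).trace.re ≤
        (projMatrix ((szSector (Λ := FermionTorus 2 L) (2 * ⌊(1 - δ) * (L : ℝ) ^ 2 / 2⌋₊) 0).map
              (Fock.toEuclidean (ι := Orb (FermionTorus 2 L)) :
                Fock (Orb (FermionTorus 2 L)) →ₗ[ℂ]
                  EuclideanSpace ℂ (Finset (Orb (FermionTorus 2 L))))) *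
            gibbsWeight β (hubbardTorus 2 L 1 U + ((κ' / (L : ℝ) ^ 4 : ℝ) : ℂ) •
              ((pairField dWaveFormFactor L)ᴴ * pairField dWaveFormFactor L)) *
          ((pairField dWaveFormFactor L)ᴴ * pairField dWaveFormFactor L)).trace.re)
      (Ct := fun β σ => Real.log ((projMatrix ((szSector (Λ := FermionTorus 2 L)
            (2 * ⌊(1 - δ) * (L : ℝ) ^ 2 / 2⌋₊) 0).map
              (Fock.toEuclidean (ι := Orb (FermionTorus 2 L)) :
                Fock (Orb (FermionTorus 2 L)) →ₗ[ℂ]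
                  EuclideanSpace ℂ (Finset (Orb (FermionTorus 2 L))))) *
          gibbsWeight β (hubbardTorus 2 L 1 U -
            ((((hubbardTorus 2 L 1 U).minEnergyOn
              (szSector (Λ := FermionTorus 2 L) (2 * ⌊(1 - δ) * (L : ℝ) ^ 2 / 2⌋₊) 0) : ℝ) : ℂ) •
              (1 : Matrix (Finset (Orb (FermionTorus 2 L))) (Finset (Orb (FermionTorus 2 L))) ℂ)))).trace.re) ≤ σ)
      hfl
  · refine ⟨δ, hδ, U₁, U₂, x, hU₁, hU₁₂, hx, fun U hU => ?_⟩
    obtain ⟨L₀, hL₀⟩ := h U hU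
    refine ⟨L₀, fun L _ hL hLe => ?_⟩
    obtain ⟨hfl, hct⟩ := hL₀ L hL hLe
    exact freeFloorAt_of_isotropicFloorAt L hκ hθ hC
      (Fl := fun β κ' => x * (L : ℝ) ^ 4 *
          (projMatrix ((szSector (Λ := FermionTorus 2 L) (2 * ⌊(1 - δ) * (L : ℝ) ^ 2 / 2⌋₊) 0).map
              (Fock.toEuclidean (ι := Orb (FermionTorus 2 L)) :
                Fock (Orb (FermionTorus 2 L)) →ₗ[ℂ]
                  EuclideanSpace ℂ (Finset (Orb (FermionTorus 2 L))))) *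
            gibbsWeight β (hubbardTorus 2 L 1 U + ((κ' / (L : ℝ) ^ 4 : ℝ) : ℂ) •
              ((pairField dWaveFormFactor L)ᴴ * pairField dWaveFormFactor L))).trace.re ≤
        (projMatrix ((szSector (Λ := FermionTorus 2 L) (2 * ⌊(1 - δ) * (L : ℝ) ^ 2 / 2⌋₊) 0).map
              (Fock.toEuclidean (ι := Orb (FermionTorus 2 L)) :
                Fock (Orb (FermionTorus 2 L)) →ₗ[ℂ]
                  EuclideanSpace ℂ (Finset (Orb (FermionTorus 2 L))))) *
            gibbsWeight β (hubbardTorus 2 L 1 U + ((κ' / (L : ℝ) ^ 4 : ℝ) : ℂ) •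
              ((pairField dWaveFormFactor L)ᴴ * pairField dWaveFormFactor L)) *
          ((pairField dWaveFormFactor L)ᴴ * pairField dWaveFormFactor L)).trace.re)
      (Ct := fun β σ => Real.log ((projMatrix ((szSector (Λ := FermionTorus 2 L)
            (2 * ⌊(1 - δ) * (L : ℝ) ^ 2 / 2⌋₊) 0).map
              (Fock.toEuclidean (ι := Orb (FermionTorus 2 L)) :
                Fock (Orb (FermionTorus 2 L)) →ₗ[ℂ]
                  EuclideanSpace ℂ (Finset (Orb (FermionTorus 2 L))))) *
          gibbsWeight β (hubbardTorus 2 L 1 U -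
            ((((hubbardTorus 2 L 1 U).minEnergyOn
              (szSector (Λ := FermionTorus 2 L) (2 * ⌊(1 - δ) * (L : ℝ) ^ 2 / 2⌋₊) 0) : ℝ) : ℂ) •
              (1 : Matrix (Finset (Orb (FermionTorus 2 L))) (Finset (Orb (FermionTorus 2 L))) ℂ)))).trace.re) ≤ σ)
      hfl hct

end Hubbard

end Summit.HubbardSuperconductivity.HubbardSuperconductivity.Theorems.BirGroundStateAverageLRO.Softmin
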